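import Mathlib
import HarnessLib
import Summits.NavierStokesRegularity.NavierStokesRegularity.Theorems.UnthreadedRigidityDoorUnthreadedRigidityTwoShellQuinticLaw

/-!
# Route `UnthreadedRigidityDoor`, item `UnthreadedRigidity` (W2, stmt-NavierStokesRegularity-27585) — LINE g12-1 «CO-ZONAL» rung family:
# ★★ `TwoShellWindowRigidity 2 3` and `3 2` — the first ODD top degree: quartic law `K⁴ = C·H²`, constant signs from the order of zeros

Prover file (engine-1 g74; `--supports stmt-NavierStokesRegularity-27585 --as helper`; route-independent imports).

For a consecutive two-shell window with ODD top degree `L = 3` the sphere coefficients give `b₃[H] ≡ 0`, hence the QUARTIC LAW `K⁴ = C·H²`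
(`powerLaw`), whose even exponents carry no sign — the obstruction recorded in `…TwoShellQuinticLaw`.  Here the sign is recovered from the ORDER
OF ZEROS: at a common zero `r₁ > 0` of `K` and `H` (the quartic law makes their zeros coincide; `C > 0`) with `ord K = k`, `ord H = h`, the
law gives `4k = 2h` and the definition `K = H″ + 8H′/r` gives `k = h − 2` (`ord H″ = h−2 < h−1 = ord (8H′/r)`), so `(h, k) = (4, 2)` and
`ord (K·H) = 6` is EVEN; off the zeros the order is `0`.  A real-analytic function on `(0,∞)` all of whose orders are finite and even keeps a
constant sign (`constant_sign_of_even_order`: the sets «locally `≥ 0`» / «locally `≤ 0`» are open, disjoint and cover the connected `(0,∞)`).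
Hence `K·H ≥ 0` on `(0,∞)` (⇒ `H ≡ 0` by `eq_zero_of_bL_eq_zero_of_nonneg`) or `K·H ≤ 0` (⇒ `H ≡ 0` by
`eq_zero_of_bL_eq_zero_of_nonpos_of_decay` with the decay `|H| = K²/√C ≤ D·r^{−14} ≤ D·r^{−10}`):
* `constant_sign_of_even_order`; ★ `quarticLawNonexistence` (`L = 3`: `b₃ ≡ 0 ⇒ H ≡ 0`);
* ★ `twoShell_window_vanishes_three_two`, ★★ `twoShellWindowRigidity_three_two : TwoShellWindowRigidity 3 2`, ★★ `twoShellWindowRigidity_two_three`,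
  the residuals, and the updated opposite-parity table `twoShellWindowRigidity_of_odd_sum'` (gap `≥ 2` ∨ sum `∈ {3, 5, 7}`).
What stays OPEN in the family: consecutive pairs with top degree `L ≥ 5` — the order argument is degree-uniform (`(L+1)k = (L−1)h` and
`k = h − 2` give `(h, k) = (L+1, L−1)`, `ord(KH) = 2L` even, so `KH` keeps a constant sign in EVERY degree and the branch `KH ≥ 0` closes by
`eq_zero_of_bL_eq_zero_of_nonneg`), but the branch `KH ≤ 0` needs the decay `|H| = O(r^{−(3L+1)})`, which the one-step bootstrap
`O(r^{−(L+4)(L+1)/(L−1)})` supplies only for `L ≤ 4` — and all same-parity pairs.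

HONEST LABEL: RUNGS about SPECIAL hypothetical two-shell windows (the class is EMPTY) + elementary ODE/analytic-order lemmas; support for
`UnthreadedRigidity` (27585), which stays OPEN with the door Target, W2 and Navier–Stokes regularity; no summit statement is proved.  0 kit.  [folklore]
-/

noncomputable section

-- the summit and its single sub-problem share the name (CONVENTIONS §1), as in every Theorems file
set_option linter.dupNamespace false

namespace Summit.NavierStokesRegularity.NavierStokesRegularity.Theorems.UnthreadedRigidity.MixedPair

open Set Function Filter Topology
open scoped RealInnerProductSpace
open Literature.Analysis Literature.Analysis.FluidPDE
open Literature.Analysis.UnboundedOperators (heatExtension)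
open Summit.NavierStokesRegularity.NavierStokesRegularity.Theorems.UnthreadedRigidity.ProfileHorn (E3)
open Summit.NavierStokesRegularity.NavierStokesRegularity.Theorems.UnthreadedRigidity.VirialHorn
  (IsSolidHarmonic VirialAdmissible sepShellL vortAmpL strainAmpL exists_skew_ne_zero window_analyticOnNhd_slice)
open Summit.NavierStokesRegularity.NavierStokesRegularity.Theorems.UnthreadedRigidity.ThreadingJets (analyticOnNhd_vortAmpL
  eq_zero_of_vortAmpL_eq_zero)
open Summit.NavierStokesRegularity.NavierStokesRegularity.Theorems.UnthreadedRigidity.CoZonal (twoShellL TwoShellWindowRigidity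
  LinkedPairWindowRigidity)
open Summit.NavierStokesRegularity.NavierStokesRegularity.Theorems.UnthreadedRigidity.Persistence (singleShellWindowVanishes sepShellL_null_of_pos)

/-! ## §1 Constant sign from even orders -/

/-- LOCAL SIGN: an analytic function with finite EVEN order at `r` is `≥ 0` near `r` or `≤ 0` near `r`. [folklore] -/
theorem eventually_nonneg_or_nonpos_of_even_order {P : ℝ → ℝ} {r : ℝ} (hP : AnalyticAt ℝ P r) {n : ℕ}
    (hord : analyticOrderAt P r = (2 * n : ℕ)) : (∀ᶠ s in 𝓝 r, 0 ≤ P s) ∨ (∀ᶠ s in 𝓝 r, P s ≤ 0) := by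
  obtain ⟨g, hg, hg0, hPg⟩ := (hP.analyticOrderAt_eq_natCast).mp hord
  rcases lt_or_gt_of_ne hg0 with hneg | hpos
  · right
    filter_upwards [hPg, hg.continuousAt.eventually_lt continuousAt_const hneg] with s hs hgs
    rw [hs, smul_eq_mul, pow_mul]
    exact mul_nonpos_of_nonneg_of_nonpos (pow_nonneg (sq_nonneg _) _) hgs.le
  · left
    filter_upwards [hPg, continuousAt_const.eventually_lt hg.continuousAt hpos] with s hs hgs
    rw [hs, smul_eq_mul, pow_mul]
    exact mul_nonneg (pow_nonneg (sq_nonneg _) _) hgs.le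

/-- ★ CONSTANT SIGN FROM EVEN ORDERS: a function analytic on `(0,∞)` all of whose orders there are finite and even is `≥ 0` on `(0,∞)` or
`≤ 0` on `(0,∞)` (the two «local sign» sets are open, disjoint — a point in both has infinite order — and cover the connected `(0,∞)`). [folklore] -/
theorem constant_sign_of_even_order {P : ℝ → ℝ} (hP : AnalyticOnNhd ℝ P (Ioi 0))
    (heven : ∀ r : ℝ, 0 < r → ∃ n : ℕ, analyticOrderAt P r = (2 * n : ℕ)) :
    (∀ r : ℝ, 0 < r → 0 ≤ P r) ∨ (∀ r : ℝ, 0 < r → P r ≤ 0) := by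
  set A : Set ℝ := {r | ∀ᶠ s in 𝓝 r, 0 ≤ P s} with hA
  set B : Set ℝ := {r | ∀ᶠ s in 𝓝 r, P s ≤ 0} with hB
  have hAo : IsOpen A := isOpen_setOf_eventually_nhds
  have hBo : IsOpen B := isOpen_setOf_eventually_nhds
  have hcover : Ioi (0 : ℝ) ⊆ A ∪ B := fun r hr => by
    obtain ⟨n, hn⟩ := heven r hr
    rcases eventually_nonneg_or_nonpos_of_even_order (hP r hr) hn with h | h
    · exact Or.inl h
    · exact Or.inr h
  have hdisj : Disjoint (Ioi (0 : ℝ) ∩ A) (Ioi (0 : ℝ) ∩ B) := by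
    rw [Set.disjoint_left]
    rintro r ⟨hr, hrA⟩ ⟨-, hrB⟩
    obtain ⟨n, hn⟩ := heven r hr
    have hzero : ∀ᶠ s in 𝓝 r, P s = 0 := by
      filter_upwards [hrA, hrB] with s h1 h2 using le_antisymm h2 h1
    have htop : analyticOrderAt P r = ⊤ := analyticOrderAt_eq_top.mpr hzero
    rw [hn] at htop
    exact ENat.coe_ne_top _ htop
  -- `(0,∞)` is preconnected: it lies in one of the two relatively open pieces
  have hpre : IsPreconnected (Ioi (0 : ℝ)) := isPreconnected_Ioi
  have h1 : (1 : ℝ) ∈ Ioi (0 : ℝ) := by norm_num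
  rcases hcover h1 with h1A | h1B
  · left
    have hsub : Ioi (0 : ℝ) ⊆ A := by
      have h := hpre.subset_left_of_subset_union (u := Ioi 0 ∩ A) (v := Ioi 0 ∩ B) (isOpen_Ioi.inter hAo) (isOpen_Ioi.inter hBo) hdisj
        (fun r hr => by rcases hcover hr with h | h; exacts [Or.inl ⟨hr, h⟩, Or.inr ⟨hr, h⟩]) ⟨1, h1, h1, h1A⟩
      exact fun r hr => (h hr).2
    exact fun r hr => (hsub hr).self_of_nhds
  · right
    have hsub : Ioi (0 : ℝ) ⊆ B := by
      have hdisj' : Disjoint (Ioi (0 : ℝ) ∩ B) (Ioi (0 : ℝ) ∩ A) := hdisj.symm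
      have h := hpre.subset_left_of_subset_union (u := Ioi 0 ∩ B) (v := Ioi 0 ∩ A) (isOpen_Ioi.inter hBo) (isOpen_Ioi.inter hAo) hdisj'
        (fun r hr => by rcases hcover hr with h | h; exacts [Or.inr ⟨hr, h⟩, Or.inl ⟨hr, h⟩]) ⟨1, h1, h1, h1B⟩
      exact fun r hr => (h hr).2
    exact fun r hr => (hsub hr).self_of_nhds

/-! ## §2 The quartic law `K⁴ = C·H²` (`L = 3`) has no admissible solution -/

/-- ★ **QUARTIC-LAW NONEXISTENCE** (`L = 3`): a virial-admissible degree-3 profile, real-analytic on `(0,∞)`, with `b₃[H] ≡ 0` vanishes on `(0,∞)`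
(module docstring: power law `K⁴ = CH²`, orders `(h,k) = (4,2)` at every common zero, constant sign of `KH`, then the landed sign branches). -/
theorem quarticLawNonexistence {H : ℝ → ℝ} (hH : VirialAdmissible 3 H) (hHa : AnalyticOnNhd ℝ H (Set.Ioi 0))
    (hb : ∀ r : ℝ, 0 < r →
      ((3 : ℕ) : ℝ) / (2 * r) * ((((3 : ℕ) : ℝ) - 1) * vortAmpL 3 H r * deriv H r - (((3 : ℕ) : ℝ) + 1) * deriv (vortAmpL 3 H) r * H r) = 0) :
    ∀ r : ℝ, 0 < r → H r = 0 := by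
  by_contra hne
  push Not at hne
  obtain ⟨r₀, hr₀, hH0⟩ := hne
  obtain ⟨C, hKC⟩ := powerLaw 1 H hH hHa hb
  set K : ℝ → ℝ := vortAmpL 3 H with hKdef
  have hK : AnalyticOnNhd ℝ K (Ioi 0) := analyticOnNhd_vortAmpL hHa
  have hKC' : ∀ r : ℝ, 0 < r → K r ^ 4 = C * H r ^ 2 := fun r hr => by simpa using hKC r hr
  -- `C > 0`
  have hC : 0 < C := by
    rcases lt_trichotomy C 0 with h | h | h
    · exfalso
      have h1 := hKC' r₀ hr₀
      have h2 : 0 ≤ K r₀ ^ 4 := by positivity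
      have h3 : C * H r₀ ^ 2 < 0 := mul_neg_of_neg_of_pos h (by positivity)
      linarith
    · exfalso
      subst h
      have hK0 : ∀ r : ℝ, 0 < r → K r = 0 := fun r hr => by
        have h1 := hKC' r hr
        rw [zero_mul] at h1
        exact (pow_eq_zero_iff (by norm_num)).1 h1
      exact hH0 (eq_zero_of_vortAmpL_eq_zero hH hK0 r₀ hr₀).1
    · exact h
  -- `H` and `K` are nowhere locally zero on `(0,∞)`
  have hHloc : ∀ r : ℝ, 0 < r → analyticOrderAt H r ≠ ⊤ := by
    intro r hr htop
    have hz := hHa.eqOn_zero_of_preconnected_of_eventuallyEq_zero isPreconnected_Ioi hr (analyticOrderAt_eq_top.mp htop)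
    exact hH0 (hz hr₀)
  have hKne : ∀ r : ℝ, 0 < r → H r ≠ 0 → K r ≠ 0 := by
    intro r hr hHr hKr
    have h1 := hKC' r hr
    rw [hKr, zero_pow (by norm_num)] at h1
    exact hHr (pow_eq_zero_iff two_ne_zero |>.mp ((mul_eq_zero.mp h1.symm).resolve_left hC.ne'))
  have hKloc : ∀ r : ℝ, 0 < r → analyticOrderAt K r ≠ ⊤ := by
    intro r hr htop
    have hz := hK.eqOn_zero_of_preconnected_of_eventuallyEq_zero isPreconnected_Ioi hr (analyticOrderAt_eq_top.mp htop)
    exact hKne r₀ hr₀ hH0 (hz hr₀)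
  -- ★ every order of `P = K·H` on `(0,∞)` is even
  have heven : ∀ r : ℝ, 0 < r → ∃ n : ℕ, analyticOrderAt (fun s => K s * H s) r = (2 * n : ℕ) := by
    intro r hr
    rw [show (fun s => K s * H s) = K * H from rfl]
    have hHa_r : AnalyticAt ℝ H r := hHa r hr
    have hKa_r : AnalyticAt ℝ K r := hK r hr
    by_cases hPr : K r * H r ≠ 0
    · refine ⟨0, ?_⟩
      rw [Nat.mul_zero, Nat.cast_zero, (hKa_r.mul hHa_r).analyticOrderAt_eq_zero]
      exact hPr
    · -- a common zero: `H r = 0` and `K r = 0`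
      push Not at hPr
      have hHr : H r = 0 := by
        by_contra h
        exact hKne r hr h ((mul_eq_zero.mp hPr).resolve_right h)
      have hKr : K r = 0 := by
        have h1 := hKC' r hr
        rw [hHr, zero_pow two_ne_zero, mul_zero] at h1
        exact (pow_eq_zero_iff (by norm_num)).mp h1
      obtain ⟨h, hh⟩ := ENat.ne_top_iff_exists.mp (hHloc r hr)
      obtain ⟨k, hk⟩ := ENat.ne_top_iff_exists.mp (hKloc r hr)
      -- `4k = 2h` from the quartic law
      have hlaw : 4 * k = 2 * h := by
        have e1 : analyticOrderAt (K ^ 4) r = 4 • analyticOrderAt K r := analyticOrderAt_pow hKa_r 4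
        have e2 : analyticOrderAt ((fun _ : ℝ => C) * H ^ 2) r = 0 + 2 • analyticOrderAt H r := by
          rw [analyticOrderAt_mul analyticAt_const (hHa_r.pow 2), analyticAt_const.analyticOrderAt_eq_zero.mpr hC.ne',
            analyticOrderAt_pow hHa_r 2]
        have e3 : analyticOrderAt (K ^ 4) r = analyticOrderAt ((fun _ : ℝ => C) * H ^ 2) r := by
          apply analyticOrderAt_congr
          filter_upwards [Ioi_mem_nhds hr] with s hs
          simp only [Pi.pow_apply, Pi.mul_apply]
          exact hKC' s hs
        rw [e1, e2, ← hk, ← hh, zero_add] at e3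
        have e4 : ((4 * k : ℕ) : ℕ∞) = ((2 * h : ℕ) : ℕ∞) := by
          rw [Nat.cast_mul, Nat.cast_mul]
          simpa [nsmul_eq_mul] using e3
        exact_mod_cast e4
      -- `k ≥ 1`, so `h = h' + 2`
      have hk1 : 1 ≤ k := by
        by_contra h0
        have hk0 : k = 0 := by omega
        rw [hk0, Nat.cast_zero] at hk
        exact ((hKa_r.analyticOrderAt_eq_zero).mp hk.symm) hKr
      obtain ⟨h', rfl⟩ : ∃ h', h = h' + 2 := ⟨h - 2, by omega⟩
      -- orders of `H′`, `H″`, `8H′/s`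
      have hH1 : analyticOrderAt (deriv H) r = (h' + 1 : ℕ) :=
        analyticOrderAt_deriv_of_pos hHa_r (by rw [← hh]; push_cast; ring)
      have hH2 : analyticOrderAt (deriv (deriv H)) r = (h' : ℕ) :=
        analyticOrderAt_deriv_of_pos hHa_r.deriv (by rw [hH1]; push_cast; ring)
      have hinv : AnalyticAt ℝ (fun s : ℝ => 8 / s) r := analyticAt_const.div analyticAt_id hr.ne'
      have hmix : analyticOrderAt ((fun s : ℝ => 8 / s) * deriv H) r = (h' + 1 : ℕ) := by
        rw [analyticOrderAt_mul hinv hHa_r.deriv, hinv.analyticOrderAt_eq_zero.mpr (div_ne_zero (by norm_num) hr.ne'), hH1, zero_add]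
      have hKfun : K = deriv (deriv H) + (fun s : ℝ => 8 / s) * deriv H := by
        funext s
        simp only [hKdef, vortAmpL, Pi.add_apply, Pi.mul_apply]
        norm_num
      have hordK : analyticOrderAt K r = (h' : ℕ) := by
        rw [hKfun, analyticOrderAt_add_eq_left_of_lt (by rw [hH2, hmix]; exact_mod_cast (by omega : h' < h' + 1)), hH2]
      rw [← hk] at hordK
      have hk2 : k = h' := by exact_mod_cast hordK
      subst hk2
      have hh2 : k = 2 := by omega
      subst hh2
      refine ⟨3, ?_⟩
      rw [analyticOrderAt_mul hKa_r hHa_r, ← hk, ← hh]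
      all_goals norm_num
  -- ★ constant sign of `K·H`, then the two landed branches
  have hPa : AnalyticOnNhd ℝ (fun s => K s * H s) (Ioi 0) := fun r hr => (hK r hr).mul (hHa r hr)
  rcases constant_sign_of_even_order hPa heven with hpos | hneg
  · exact hH0 (eq_zero_of_bL_eq_zero_of_nonneg (L := 3) (by norm_num) hH hHa hb hpos r₀ hr₀)
  · -- decay `|H| ≤ D / r^{10}` from `H² = K⁴/C`, `|K| ≤ M r^{−7}`
    obtain ⟨M, hM0, hM⟩ := decay_profile hH
    set D : ℝ := Real.sqrt (M ^ 4 / C) with hD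
    have hD0 : 0 ≤ D := Real.sqrt_nonneg _
    have hD2 : D ^ 2 = M ^ 4 / C := by rw [hD, Real.sq_sqrt (by positivity)]
    have hdec : ∀ s : ℝ, 1 ≤ s → |H s| ≤ D / s ^ (3 * 3 + 1) := by
      intro s hs
      have hs0 : 0 < s := lt_of_lt_of_le one_pos hs
      obtain ⟨-, -, hKs⟩ := hM s hs
      have h1 : |H s| ^ 2 = |K s| ^ 4 / C := by
        have h2 := hKC' s hs0
        rw [← sq_abs (H s), ← Even.pow_abs (by decide : Even 4)] at h2
        field_simp
        linarith
      have h4 : |H s| ^ 2 ≤ (D / s ^ 10) ^ 2 := by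
        rw [h1, div_pow, hD2]
        calc |K s| ^ 4 / C ≤ (M / s ^ (3 + 4)) ^ 4 / C := by gcongr
          _ = M ^ 4 / C / s ^ 28 := by rw [div_pow, ← pow_mul]; ring
          _ ≤ M ^ 4 / C / (s ^ 10) ^ 2 := by
              apply div_le_div_of_nonneg_left (by positivity) (by positivity)
              rw [← pow_mul]
              exact pow_le_pow_right₀ hs (by norm_num)
      exact (pow_le_pow_iff_left₀ (abs_nonneg _) (by positivity) two_ne_zero).mp h4
    exact hH0 (eq_zero_of_bL_eq_zero_of_nonpos_of_decay (L := 3) (by norm_num) hH hHa hb hneg hKne hD0 hdec r₀ hr₀)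

/-! ## §3 ★★ The rungs `(3,2)` and `(2,3)` -/

variable {S : Set ℝ} {u : ℝ → E3 → E3} {x₀ : E3}

/-- ★ **TWO-SHELL WINDOWS OF DEGREES `(3,2)` VANISH**: the top (odd) profile has `b₃ ≡ 0` (`twoShell_sphere_coefficients`), hence is null by the
quartic law, and single-shell windows vanish. -/
theorem twoShell_window_vanishes_three_two (hS : IsOpen S) (hcont : ContinuousOn (uncurry u) (S ×ˢ univ))
    (hdiv : ∀ t ∈ S, VectorCalculus.IsDivFree (u t))
    (hmild : ∀ s ∈ S, ∀ t ∈ S, s < t → ∀ x, u t x = heatExtension (u s) (t - s) x - oseenDuhamel 1 s u u t x)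
    (hbdd : ∀ τ ∈ S, ∃ B : ℝ, ∀ t ∈ S, t ≤ τ → ∀ x, ‖u t x‖ ≤ B)
    {Y₁ Y₂ : E3 → ℝ} (hY₁ : IsSolidHarmonic 3 Y₁) (hY₂ : IsSolidHarmonic 2 Y₂) (hY₁ne : ∃ y, Y₁ y ≠ 0) (hY₂ne : ∃ y, Y₂ y ≠ 0)
    {H₁f H₂f : ℝ → ℝ → ℝ} (hH₁ : ∀ t ∈ S, VirialAdmissible 3 (H₁f t)) (hH₂ : ∀ t ∈ S, VirialAdmissible 2 (H₂f t))
    (hshape : ∀ t ∈ S, u t = twoShellL (H₁f t) (H₂f t) Y₁ Y₂ x₀) :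
    ∀ t ∈ S, ∀ x, u t x = 0 := by
  have hl₁ : Odd 3 := by decide
  have hl₂ : Even 2 := by decide
  have hH₁null : ∀ t ∈ S, ∀ r : ℝ, 0 < r → H₁f t r = 0 := by
    intro t ht
    have hbal := twoShell_window_toroidal_balance hS hcont hdiv hmild hbdd hl₁ hl₂ hY₁ hY₂ hH₁ hH₂ hshape ht
    rw [hshape t ht] at hbal
    have han : AnalyticOnNhd ℝ (twoShellL (H₁f t) (H₂f t) Y₁ Y₂ x₀) univ := by
      rw [← hshape t ht]; exact window_analyticOnNhd_slice hS hcont hmild hbdd ht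
    have hA1 : AnalyticOnNhd ℝ (H₁f t) (Ioi 0) :=
      analyticOnNhd_twoShellProfile_odd hl₁ hl₂ (by norm_num) (by norm_num) hY₁ hY₂ hY₁ne (hH₁ t ht) (hH₂ t ht) han
    refine quarticLawNonexistence (hH₁ t ht) hA1 fun r hr => ?_
    obtain ⟨e, C, hrel⟩ := twoShell_sphere_relation hl₁ hl₂ (by norm_num) (by norm_num) hY₁ hY₂ (hH₁ t ht) (hH₂ t ht) x₀ hbal hr
    have hcoef := twoShell_sphere_coefficients (Y_T := Y₁) (Y_B := Y₂) (L := 3) (ℓ := 2) (by norm_num) (by norm_num) hY₁ hY₂ hY₁ne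
      (A_T := -(vortAmpL 3 (H₁f t) r * strainAmpL 3 (H₁f t) r) * (r ^ ((3 : ℤ) - 1)) ^ 2)
      (B_T := (3 : ℝ) / (2 * r) * (((3 : ℝ) - 1) * vortAmpL 3 (H₁f t) r * deriv (H₁f t) r
          - ((3 : ℝ) + 1) * deriv (vortAmpL 3 (H₁f t)) r * H₁f t r) * (r ^ 3) ^ 2)
      (A_B := -(vortAmpL 2 (H₂f t) r * strainAmpL 2 (H₂f t) r) * (r ^ ((2 : ℤ) - 1)) ^ 2)
      (B_B := (2 : ℝ) / (2 * r) * (((2 : ℝ) - 1) * vortAmpL 2 (H₂f t) r * deriv (H₂f t) r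
          - ((2 : ℝ) + 1) * deriv (vortAmpL 2 (H₂f t)) r * H₂f t r) * (r ^ 2) ^ 2)
      (E_T := 0) (E_B := -(e * r ^ 2)) (C₀ := C) (Or.inl rfl) (Or.inr hl₂)
      (fun w hw => by have h := hrel w hw; push_cast at h ⊢; linear_combination h)
    have hB := hcoef.1
    have hpow : (r ^ 3) ^ 2 ≠ 0 := by positivity
    have h1 := (mul_eq_zero.mp hB).resolve_right hpow
    push_cast
    linear_combination h1
  have hshape' : ∀ t ∈ S, u t = sepShellL (H₂f t) Y₂ x₀ := by
    intro t ht
    rw [hshape t ht]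
    funext x
    show sepShellL (H₁f t) Y₁ x₀ x + sepShellL (H₂f t) Y₂ x₀ x = _
    rw [sepShellL_null_of_pos (H₁f t) Y₁ x₀ (hH₁null t ht) x, zero_add]
  exact singleShellWindowVanishes 2 (by norm_num) S hS u x₀ hcont hdiv hmild hbdd Y₂ H₂f hY₂ hY₂ne hH₂ hshape'

/-- ★★ **`TwoShellWindowRigidity 3 2` HOLDS.** -/
theorem twoShellWindowRigidity_three_two : TwoShellWindowRigidity 3 2 := by
  intro S hS _ u x₀ hcont hdiv hmild hbdd _ Y₁ Y₂ H₁f H₂f hY₁ hY₂ hY₁ne hY₂ne hH₁ hH₂ hshape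
  have hzero := twoShell_window_vanishes_three_two hS hcont hdiv hmild hbdd hY₁ hY₂ hY₁ne hY₂ne hH₁ hH₂ hshape
  obtain ⟨A, hskew, hA0⟩ := exists_skew_ne_zero
  refine ⟨A, hskew, hA0, fun t ht x => ?_⟩
  have hut : u t = fun _ => (0 : E3) := funext (hzero t ht)
  rw [hut]
  simp

/-- ★★ **`TwoShellWindowRigidity 2 3` HOLDS** (the summands swapped). -/
theorem twoShellWindowRigidity_two_three : TwoShellWindowRigidity 2 3 := by
  intro S hS hconn u x₀ hcont hdiv hmild hbdd hunth Y₂ Y₁ H₂f H₁f hY₂ hY₁ hY₂ne hY₁ne hH₂ hH₁ hshape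
  refine twoShellWindowRigidity_three_two S hS hconn u x₀ hcont hdiv hmild hbdd hunth Y₁ Y₂ H₁f H₂f hY₁ hY₂ hY₁ne hY₂ne hH₁ hH₂
    fun t ht => ?_
  rw [hshape t ht]
  funext x
  simp only [twoShellL]
  rw [add_comm]

/-- the residual R of LINE g12-1 at `(3,2)` holds a fortiori. -/
theorem linkedPairWindowRigidity_three_two : LinkedPairWindowRigidity 3 2 :=
  fun S hS hc u x₀ h1 h2 h3 h4 h5 Y₁ Y₂ H₁f H₂f hY₁ hY₂ hn₁ hn₂ _ hH₁ hH₂ hsh _ =>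
    twoShellWindowRigidity_three_two S hS hc u x₀ h1 h2 h3 h4 h5 Y₁ Y₂ H₁f H₂f hY₁ hY₂ hn₁ hn₂ hH₁ hH₂ hsh

/-- the residual R at `(2,3)`. -/
theorem linkedPairWindowRigidity_two_three : LinkedPairWindowRigidity 2 3 :=
  fun S hS hc u x₀ h1 h2 h3 h4 h5 Y₁ Y₂ H₁f H₂f hY₁ hY₂ hn₁ hn₂ _ hH₁ hH₂ hsh _ =>
    twoShellWindowRigidity_two_three S hS hc u x₀ h1 h2 h3 h4 h5 Y₁ Y₂ H₁f H₂f hY₁ hY₂ hn₁ hn₂ hH₁ hH₂ hsh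

/-- ★★ THE OPPOSITE-PARITY TABLE BY NAME, updated: gap `≥ 2` (p732884) ∨ `{1,2}` (p728070) ∨ `{2,3}` (here) ∨ `{3,4}` (p734108). -/
theorem twoShellWindowRigidity_of_odd_sum' {l₁ l₂ : ℕ} (hd₁ : 1 ≤ l₁) (hd₂ : 1 ≤ l₂) (hodd : Odd (l₁ + l₂))
    (hcase : l₁ + 2 ≤ l₂ ∨ l₂ + 2 ≤ l₁ ∨ l₁ + l₂ ≤ 7) : TwoShellWindowRigidity l₁ l₂ := by
  by_cases h5 : l₁ + l₂ = 5
  · have hne : l₁ ≠ l₂ := fun h => by omega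
    rcases Nat.lt_or_gt_of_ne hne with h12 | h12
    · by_cases h14 : l₁ + 2 ≤ l₂
      · exact twoShellWindowRigidity_of_odd_sum hd₁ hd₂ hodd (Or.inl h14)
      · obtain ⟨rfl, rfl⟩ : l₁ = 2 ∧ l₂ = 3 := by omega
        exact twoShellWindowRigidity_two_three
    · by_cases h14 : l₂ + 2 ≤ l₁
      · exact twoShellWindowRigidity_of_odd_sum hd₁ hd₂ hodd (Or.inr (Or.inl h14))
      · obtain ⟨rfl, rfl⟩ : l₁ = 3 ∧ l₂ = 2 := by omega
        exact twoShellWindowRigidity_three_two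
  · refine twoShellWindowRigidity_of_odd_sum hd₁ hd₂ hodd ?_
    rcases hcase with h | h | h
    · exact Or.inl h
    · exact Or.inr (Or.inl h)
    · -- odd sum `≤ 7`, `≠ 5`: `3` or `7` (sum `1` is impossible with both degrees `≥ 1`)
      obtain ⟨k, hk⟩ := hodd
      right; right
      omega

end Summit.NavierStokesRegularity.NavierStokesRegularity.Theorems.UnthreadedRigidity.MixedPair

end
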